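import Literature.Probability.RandomPlanarGeometry.HalfPlaneAutomorphism
import HarnessLib

/-!
# Boundary correspondence of a chordal uniformizing map: images of half-plane test sets

A step (T3 of the plan in `ConformalRestrictionProofs`) of the transposition of [LSW] Thm. 6.1
(G. F. Lawler, O. Schramm, W. Werner, *Conformal restriction: the chordal case*, J. Amer. Math.
Soc. **16** (2003), arXiv:math/0209343) to `Literature.Probability.RandomPlanarGeometry.IsSLELaw.hullRestriction_eightThirds`: the
restriction identity for the SLE_{8/3} laws of `(D; a, b)` is tested on the avoidance events of
the images `φ.boundaryExtension '' S` of half-plane test sets `S ⊆ ℍ̄` (compact, `0 ∉ S`) under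
the boundary extension of a chordal uniformizing map `φ : (ℍ; 0, ∞) → (D; a, b)`. From
Carathéodory's theorem in disc form (`JordanDomain.exists_continuousOn_extension`, Pommerenke
Thm. 2.6: the extension `Ψ` to the closed disc is a continuous BIJECTION onto `closure D`,
circle onto `∂D`; hypothesis `hC`) we PROVE:

* `boundaryExtension_ofReal_ne_pt_zero` / `_ne_pt_one` — a real point `x ≠ 0` is not sent to
  `a`, and no real point is sent to `b` (injectivity of `Ψ` on the closed disc: `a = Ψ(C 0)`,
  `b = Ψ(1)`, `C` the Cayley map, `C x ≠ 1`);
* `pt_notMem_image_boundaryExtension` — hence `a, b ∉ φ.boundaryExtension '' S` for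
  `S ⊆ ℍ̄` with `0 ∉ S` (points of `ℍ` go to `D ∌ a, b`);
* `isCompact_image_boundaryExtension` — the image of a compact `S ⊆ ℍ̄` is compact
  (continuity of the extension on `ℍ̄`);
* `mem_image_boundaryExtension_iff` — for `w ∈ D`: `w ∈ φ.boundaryExtension '' S ↔ φ⁻¹ w ∈ S`
  (real points go to `∂D`, which misses the open `D`);

so that a curve `{a} ∪ φ(β(0,∞)) ∪ {b}` in `D̄` avoids `φ.boundaryExtension '' S` iff the
half-plane path `β` avoids `S` on `(0, ∞)` (`disjoint_image_boundaryExtension_iff`).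
-/

noncomputable section

open Set Filter Topology Metric Complex
open UpperHalfPlane (upperHalfPlaneSet isOpen_upperHalfPlaneSet)
open scoped NNReal

namespace Literature.Probability.RandomPlanarGeometry

namespace MarkedDomain

variable {D : DobrushinDomain} {φ : ConformalEquiv upperHalfPlaneSet D.carrier}

/-- The marked points are not in the (open) domain. [folklore] -/
theorem pt_notMem_carrier (D : DobrushinDomain) (i : Fin 2) : D.pt i ∉ D.carrier := by
  have h := (D.pt_mem_frontier i).2
  rwa [D.isOpen.interior_eq] at h

/-- **A real point other than `0` is not sent to `a`** by the boundary extension of a chordal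
uniformizing map (Carathéodory: the extension to the closed disc is injective, and `a` is the
image of `C 0`). [cite: PommerenkeBBCM1992, Thm. 2.6] -/
theorem boundaryExtension_ofReal_ne_pt_zero (hC : JordanDomain.exists_continuousOn_extension)
    (hφ : D.IsChordalUniformizing φ) {x : ℝ} (hx : x ≠ 0) :
    φ.boundaryExtension x ≠ D.pt 0 := by
  obtain ⟨Ψ, hΨc, hΨeq, hbij, -⟩ := hC D.toJordanDomain (cayley.symm.trans φ)
  have hinj : InjOn Ψ (closedBall 0 1) := hbij.injOn
  intro h
  rw [JordanDomain.boundaryExtension_eq_of_extension φ hΨc hΨeq (x := x) (by simp)] at h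
  have h0 : Ψ (cayleyFun ((0 : ℝ) : ℂ)) = D.pt 0 :=
    JordanDomain.extension_cayleyFun_eq φ hΨc hΨeq (x := 0) hφ.1
  have hmem : ∀ y : ℝ, cayleyFun (y : ℂ) ∈ closedBall (0 : ℂ) 1 := fun y ↦
    mem_closedBall_zero_iff.2 (norm_cayleyFun_ofReal y).le
  have heq : cayleyFun (x : ℂ) = cayleyFun ((0 : ℝ) : ℂ) := hinj (hmem x) (hmem 0) (h.trans h0.symm)
  have hx' : (x : ℂ) = ((0 : ℝ) : ℂ) := by
    have h1 := congrArg cayleyInvFun heq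
    rwa [cayleyInvFun_cayleyFun (add_I_ne_zero (by simp)),
      cayleyInvFun_cayleyFun (add_I_ne_zero (by simp))] at h1
  exact hx (by exact_mod_cast hx')

/-- **No real point is sent to `b`** by the boundary extension of a chordal uniformizing map
(`b = Ψ 1` is the value at infinity, and `C x ≠ 1`). [cite: PommerenkeBBCM1992, Thm. 2.6] -/
theorem boundaryExtension_ofReal_ne_pt_one (hC : JordanDomain.exists_continuousOn_extension)
    (hφ : D.IsChordalUniformizing φ) (x : ℝ) : φ.boundaryExtension x ≠ D.pt 1 := by
  obtain ⟨Ψ, hΨc, hΨeq, hbij, -⟩ := hC D.toJordanDomain (cayley.symm.trans φ)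
  have hinj : InjOn Ψ (closedBall 0 1) := hbij.injOn
  intro h
  rw [JordanDomain.boundaryExtension_eq_of_extension φ hΨc hΨeq (x := x) (by simp)] at h
  have h1 : Ψ 1 = D.pt 1 := JordanDomain.extension_one_eq φ hΨc hΨeq hφ.2
  have hmem : cayleyFun (x : ℂ) ∈ closedBall (0 : ℂ) 1 :=
    mem_closedBall_zero_iff.2 (norm_cayleyFun_ofReal x).le
  have heq : cayleyFun (x : ℂ) = 1 := hinj hmem (by simp) (h.trans h1.symm)
  -- `C x = (x - i)/(x + i) = 1` is impossible
  have hx : (x : ℂ) + I ≠ 0 := add_I_ne_zero (by simp)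
  rw [cayleyFun_apply, div_eq_one_iff_eq hx] at heq
  have := congrArg Complex.im heq
  simp at this
  linarith

/-- Points of the closed half-plane other than `0` are not sent to `a`. [folklore] -/
theorem boundaryExtension_ne_pt_zero (hC : JordanDomain.exists_continuousOn_extension)
    (hφ : D.IsChordalUniformizing φ) {z : ℂ} (hz : 0 ≤ z.im) (hz0 : z ≠ 0) :
    φ.boundaryExtension z ≠ D.pt 0 := by
  rcases hz.lt_or_eq with hpos | him
  · rw [φ.boundaryExtension_eq (show z ∈ upperHalfPlaneSet from hpos)]
    exact fun h ↦ D.pt_notMem_carrier 0 (h ▸ φ.mapsTo hpos)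
  · have hzre : z = ((z.re : ℝ) : ℂ) := Complex.ext (by simp) (by simp [← him])
    rw [hzre]
    refine boundaryExtension_ofReal_ne_pt_zero hC hφ fun h ↦ hz0 ?_
    rw [hzre, h, ofReal_zero]

/-- Points of the closed half-plane are not sent to `b`. [folklore] -/
theorem boundaryExtension_ne_pt_one (hC : JordanDomain.exists_continuousOn_extension)
    (hφ : D.IsChordalUniformizing φ) {z : ℂ} (hz : 0 ≤ z.im) : φ.boundaryExtension z ≠ D.pt 1 := by
  rcases hz.lt_or_eq with hpos | him
  · rw [φ.boundaryExtension_eq (show z ∈ upperHalfPlaneSet from hpos)]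
    exact fun h ↦ D.pt_notMem_carrier 1 (h ▸ φ.mapsTo hpos)
  · have hzre : z = ((z.re : ℝ) : ℂ) := Complex.ext (by simp) (by simp [← him])
    rw [hzre]
    exact boundaryExtension_ofReal_ne_pt_one hC hφ z.re

/-- **The marked points are off the image of a half-plane test set**: for `S ⊆ ℍ̄` with `0 ∉ S`,
`a, b ∉ φ.boundaryExtension '' S`. [folklore] -/
theorem pt_notMem_image_boundaryExtension (hC : JordanDomain.exists_continuousOn_extension)
    (hφ : D.IsChordalUniformizing φ) {S : Set ℂ} (hS : S ⊆ closure upperHalfPlaneSet)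
    (h0 : (0 : ℂ) ∉ S) (i : Fin 2) : D.pt i ∉ φ.boundaryExtension '' S := by
  rintro ⟨z, hzS, hz⟩
  have hzim : 0 ≤ z.im := mem_closure_upperHalfPlaneSet_iff.1 (hS hzS)
  fin_cases i
  · exact boundaryExtension_ne_pt_zero hC hφ hzim (fun h ↦ h0 (h ▸ hzS)) hz
  · exact boundaryExtension_ne_pt_one hC hφ hzim hz

/-- The image of a compact half-plane set under the boundary extension is compact (Carathéodory:
the extension is continuous on `ℍ̄`). [cite: PommerenkeBBCM1992, Thm. 2.6] -/
theorem isCompact_image_boundaryExtension (hC : JordanDomain.exists_continuousOn_extension)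
    {S : Set ℂ} (hS : S ⊆ closure upperHalfPlaneSet) (hSc : IsCompact S) :
    IsCompact (φ.boundaryExtension '' S) :=
  hSc.image_of_continuousOn
    ((JordanDomain.continuousOn_boundaryExtension_of_disc hC D.toJordanDomain φ).mono hS)

/-- **Interior points of the image come from `ℍ`**: for `w ∈ D` and `S ⊆ ℍ̄`,
`w ∈ φ.boundaryExtension '' S ↔ φ⁻¹ w ∈ S` — real points of `S` are sent to `∂D`, which misses
the open set `D`. [folklore] -/
theorem mem_image_boundaryExtension_iff (hC : JordanDomain.exists_continuousOn_extension)
    {S : Set ℂ} (hS : S ⊆ closure upperHalfPlaneSet) {w : ℂ} (hw : w ∈ D.carrier) :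
    w ∈ φ.boundaryExtension '' S ↔ φ.symm w ∈ S := by
  constructor
  · rintro ⟨z, hzS, rfl⟩
    have hzim : 0 ≤ z.im := mem_closure_upperHalfPlaneSet_iff.1 (hS hzS)
    rcases hzim.lt_or_eq with hpos | him
    · rwa [φ.boundaryExtension_eq (show z ∈ upperHalfPlaneSet from hpos), φ.symm_apply_apply hpos]
    · -- a real point is sent to the frontier, not into `D`
      exfalso
      obtain ⟨Ψ, hΨc, hΨeq, -, -⟩ := hC D.toJordanDomain (cayley.symm.trans φ)
      have hzre : z = ((z.re : ℝ) : ℂ) := Complex.ext (by simp) (by simp [← him])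
      have hfr : φ.boundaryExtension z ∈ frontier D.carrier := by
        rw [JordanDomain.boundaryExtension_eq_of_extension φ hΨc hΨeq hzim]
        refine JordanDomain.mapsTo_frontier_of_extension hΨc hΨeq ?_
        rw [hzre]
        exact mem_sphere_zero_iff_norm.2 (norm_cayleyFun_ofReal z.re)
      have h2 := hfr.2
      rw [D.isOpen.interior_eq] at h2
      exact h2 hw
  · intro h
    have hw' : φ.symm w ∈ upperHalfPlaneSet := φ.symm_mapsTo hw
    exact ⟨φ.symm w, h, by rw [φ.boundaryExtension_eq hw', φ.apply_symm_apply hw]⟩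

/-- **Avoidance of the image test set is avoidance of the test set**: a subset `R ⊆ D ∪ {a, b}`
(the trace of a chordal curve in `D` from `a` to `b`) avoids `φ.boundaryExtension '' S`
(`S ⊆ ℍ̄`, `0 ∉ S`) iff `φ⁻¹(R ∩ D)` avoids `S`. [folklore] -/
theorem disjoint_image_boundaryExtension_iff (hC : JordanDomain.exists_continuousOn_extension)
    (hφ : D.IsChordalUniformizing φ) {S : Set ℂ} (hS : S ⊆ closure upperHalfPlaneSet)
    (h0 : (0 : ℂ) ∉ S) {R : Set ℂ} (hR : R ⊆ D.carrier ∪ {D.pt 0, D.pt 1}) :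
    Disjoint R (φ.boundaryExtension '' S) ↔ ∀ w ∈ R ∩ D.carrier, φ.symm w ∉ S := by
  constructor
  · rintro h w ⟨hwR, hwD⟩ hwS
    exact Set.disjoint_left.1 h hwR ((mem_image_boundaryExtension_iff hC hS hwD).2 hwS)
  · intro h
    refine Set.disjoint_left.2 fun w hwR hwI ↦ ?_
    rcases hR hwR with hwD | hab
    · exact h w ⟨hwR, hwD⟩ ((mem_image_boundaryExtension_iff hC hS hwD).1 hwI)
    · rcases hab with rfl | rfl
      · exact pt_notMem_image_boundaryExtension hC hφ hS h0 0 hwI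
      · exact pt_notMem_image_boundaryExtension hC hφ hS h0 1 hwI

end MarkedDomain

end Literature.Probability.RandomPlanarGeometry

end
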